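import Mathlib
import HarnessLib
import Literature.AlgebraicGeometry.Resolution.QuasiRegularSequences
import Literature.AlgebraicGeometry.Resolution.CobordantBlowupFiltration

/-!
# S1a — WEIGHTED QUASI-REGULARITY: the weighted filtration of a regular sequence with reduced quotient has REDUCED associated graded ring

[OURS · L1 W4.5c · lead-1 g10; plan-1 ASSIGNMENT v10.27 item (1), fact (F2) of K-UNIQ v2 §A] — NOT statements of the manuscript; counted 0; AI-level work, weaker
than expert review. Crux stmt-ResolutionOfSingularities-17941 `CyclicQuotientFourfolds`, line `s1a-logminvertex` v10, K-side. Route-independent; pure commutative algebra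
on top of Rees' theorem `isQuasiRegular_of_isWeaklyRegular` (Literature `QuasiRegularSequences`, [cite: Matsumura1987, Thm. 16.2]).

For `x : ι → B` QUASI-REGULAR (`I = (x)`) and positive weights `w`, the weighted filtration `𝒥ₙ = 𝒥ₙ(x, w) = (x^a : ⟨w, a⟩ ≥ n)`:
* `eval_mem_pow_of_le_degree`, `eval_mem_weightedFiltration_of_le_weight`, `exists_mvPolynomial_of_mem_weightedFiltration` — forms and filtrations;
* `IsQuasiRegular.coeff_mem_of_degree_eq_min` — if `H(x) = 0` the coefficients of the monomials of LEAST ordinary degree of `H` lie in `I`;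
* ★★ `IsQuasiRegular.coeff_mem_of_eval_eq_zero` — WEIGHTED QUASI-REGULARITY: if `H(x) = 0` and all monomials of `H` have weight `≥ ν`, the coefficients of its
  weight-`ν` monomials lie in `I` (induction on the lowest ordinary degree: certify it by quasi-regularity, rewrite its coefficients as `Σ xᵢ bᵢ` and push the
  monomials up — the new monomials have weight `> ν`); ★★ `IsQuasiRegular.coeff_mem_of_eval_mem_weightedFiltration` — same with `H(x) ∈ 𝒥_{ν+1}`, i.e.
  `gr_𝒥(B) ≅ (B/I)[X]` weighted;
* ★★★ `mem_weightedFiltration_of_pow_mem` — **GR-RED**: if moreover `B ⧸ I` is reduced then `y^N ∈ 𝒥_{Nm+1}` ⇒ `y ∈ 𝒥_{m+1}` (any `N`; for `N = 0` the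
  hypothesis says `1 ∈ 𝒥₁`); `…_of_isWeaklyRegular` for
  weakly regular sequences `f : Fin c → B`. This is hypothesis GR-RED of K-LEAST (`weightedFiltration_le_of_kill_of_filtration`) for the SIG's competitor.
-/

set_option linter.dupNamespace false

noncomputable section

open Literature.AlgebraicGeometry.Resolution
open MvPolynomial

namespace Summit.ResolutionOfSingularities.ResolutionOfSingularities.Theorems.WildQuotientResolution.S1.KillCert

universe u

variable {B : Type u} [CommRing B] {ι : Type*}

/-! ## Forms, degrees and the weighted filtration -/

/-- A polynomial all of whose monomials have ordinary degree `≥ n` evaluates into `Iⁿ`, `I = (x)`. [folklore] -/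
theorem eval_mem_pow_of_le_degree (x : ι → B) (G : MvPolynomial ι B) (n : ℕ) (h : ∀ e ∈ G.support, n ≤ e.degree) :
    eval x G ∈ Ideal.span (Set.range x) ^ n := by
  rw [G.as_sum, map_sum]
  refine Ideal.sum_mem _ fun e he => ?_
  rw [eval_monomial]
  refine Ideal.mul_mem_left _ _ (Ideal.pow_le_pow_right (h e he) ?_)
  have := (Ideal.mem_span_pow_iff_exists_isHomogeneous x (eval x (monomial e (1 : B)))).mpr ⟨monomial e 1, isHomogeneous_monomial _ rfl, rfl⟩
  rwa [eval_monomial, one_mul] at this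

/-- A polynomial all of whose monomials have weight `≥ n` evaluates into `𝒥ₙ(x, w)`. [folklore] -/
theorem eval_mem_weightedFiltration_of_le_weight (x : ι → B) (w : ι → ℕ) (G : MvPolynomial ι B) (n : ℕ)
    (h : ∀ e ∈ G.support, n ≤ Finsupp.weight w e) : eval x G ∈ (weightedFiltration x w).ideal n := by
  rw [G.as_sum, map_sum]
  refine Ideal.sum_mem _ fun e he => ?_
  rw [eval_monomial]
  exact Ideal.mul_mem_left _ _ (Ideal.subset_span ⟨e, h e he, rfl⟩)

/-- Every element of `𝒥ₙ(x, w)` is `G(x)` for a polynomial `G` all of whose monomials have weight `≥ n`. [folklore] -/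
theorem exists_mvPolynomial_of_mem_weightedFiltration (x : ι → B) (w : ι → ℕ) (n : ℕ) {y : B} (hy : y ∈ (weightedFiltration x w).ideal n) :
    ∃ G : MvPolynomial ι B, (∀ e ∈ G.support, n ≤ Finsupp.weight w e) ∧ eval x G = y := by
  classical
  rw [weightedFiltration_ideal] at hy
  refine Submodule.span_induction ?_ ?_ ?_ ?_ hy
  · rintro _ ⟨α, hα, rfl⟩
    refine ⟨monomial α 1, fun e he => ?_, by rw [eval_monomial, one_mul]⟩
    have he' := Finset.mem_singleton.mp (support_monomial_subset he)
    rw [he']; exact hα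
  · exact ⟨0, fun e he => by simp at he, map_zero _⟩
  · rintro y z - - ⟨G, hG, rfl⟩ ⟨G', hG', rfl⟩
    refine ⟨G + G', fun e he => ?_, map_add _ _ _⟩
    rcases Finset.mem_union.mp (support_add he) with h | h
    exacts [hG e h, hG' e h]
  · rintro b y - ⟨G, hG, rfl⟩
    refine ⟨MvPolynomial.C b * G, fun e he => ?_, by rw [map_mul, eval_C, smul_eq_mul]⟩
    have : coeff e (MvPolynomial.C b * G) ≠ 0 := mem_support_iff.mp he
    rw [coeff_C_mul] at this
    exact hG e (mem_support_iff.mpr (right_ne_zero_of_mul this))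

/-- `(x) ≤ 𝒥₁(x, w)` for positive weights, hence `I · 𝒥ₘ ≤ 𝒥ₘ₊₁`. [folklore] -/
theorem span_mul_weightedFiltration_le (x : ι → B) (w : ι → ℕ) (hw : ∀ i, 0 < w i) (m : ℕ) :
    Ideal.span (Set.range x) * (weightedFiltration x w).ideal m ≤ (weightedFiltration x w).ideal (m + 1) := by
  have h1 : Ideal.span (Set.range x) ≤ (weightedFiltration x w).ideal 1 := by
    rw [Ideal.span_le]
    rintro _ ⟨i, rfl⟩
    exact (weightedFiltration x w).antitone (hw i) (mem_weightedFiltration_ideal x w i)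
  rw [add_comm]
  exact (Ideal.mul_mono_left h1).trans ((weightedFiltration x w).mul_le 1 m)

/-! ## Weighted quasi-regularity -/

/-- **The coefficients of LEAST ordinary degree of a relation lie in `I`**: if `x` is quasi-regular, `H(x) = 0` and every monomial of `H` has degree `≥ d₀`, then
the coefficients of the degree-`d₀` monomials of `H` lie in `I = (x)` (the degree-`d₀` part evaluates into `I^{d₀+1}`). [folklore; Matsumura Thm. 16.2] -/
theorem IsQuasiRegular.coeff_mem_of_degree_eq_min {x : ι → B} (hx : IsQuasiRegular x) (H : MvPolynomial ι B) (hH : eval x H = 0) (d₀ : ℕ)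
    (hdeg : ∀ e ∈ H.support, d₀ ≤ e.degree) (d : ι →₀ ℕ) (hd : d.degree = d₀) : H.coeff d ∈ Ideal.span (Set.range x) := by
  classical
  set L := homogeneousComponent d₀ H with hL
  have hRest : ∀ e ∈ (H - L).support, d₀ + 1 ≤ e.degree := by
    intro e he
    have hne : coeff e (H - L) ≠ 0 := mem_support_iff.mp he
    rw [coeff_sub, hL, coeff_homogeneousComponent] at hne
    by_cases hed : e.degree = d₀
    · rw [if_pos hed, sub_self] at hne; exact absurd rfl hne
    · rw [if_neg hed, sub_zero] at hne
      have := hdeg e (mem_support_iff.mpr hne)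
      omega
  have hevL : eval x L ∈ Ideal.span (Set.range x) ^ (d₀ + 1) := by
    have e1 : eval x L = -eval x (H - L) := by rw [map_sub, hH, zero_sub, neg_neg]
    rw [e1]
    exact Submodule.neg_mem _ (eval_mem_pow_of_le_degree x _ _ hRest)
  have := (isQuasiRegular_def x).mp hx d₀ L (homogeneousComponent_isHomogeneous d₀ H) hevL d
  rwa [hL, coeff_homogeneousComponent, if_pos hd] at this

/-- ★★ **WEIGHTED QUASI-REGULARITY (relations)**: `x` quasi-regular, `w > 0`; if `H(x) = 0` and every monomial of `H` has weight `≥ ν`, then the coefficients of the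
weight-`ν` monomials of `H` lie in `I = (x)`. Induction on the lowest ordinary degree present: it is certified by `coeff_mem_of_degree_eq_min`, its coefficients
`c_e = Σ bᵢ xᵢ` are re-expanded as the monomials `x^{e+εᵢ}` of weight `> ν`, which removes the lowest degree without touching the weight-`ν` coefficients above it.
[OURS · L1 W4.5c; folklore] -/
theorem IsQuasiRegular.coeff_mem_of_eval_eq_zero [Fintype ι] {x : ι → B} (hx : IsQuasiRegular x) (w : ι → ℕ) (hw : ∀ i, 0 < w i) (ν : ℕ)
    (H : MvPolynomial ι B) (hH : eval x H = 0) (hwt : ∀ e ∈ H.support, ν ≤ Finsupp.weight w e) (d : ι →₀ ℕ) (hd : Finsupp.weight w d = ν) :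
    H.coeff d ∈ Ideal.span (Set.range x) := by
  classical
  -- induction on `m ≤ D`, all degrees of `H` in `[D - m, D]`
  suffices key : ∀ (D m : ℕ), m ≤ D → ∀ H : MvPolynomial ι B, eval x H = 0 → (∀ e ∈ H.support, ν ≤ Finsupp.weight w e) →
      (∀ e ∈ H.support, D - m ≤ e.degree ∧ e.degree ≤ D) → ∀ d, Finsupp.weight w d = ν → H.coeff d ∈ Ideal.span (Set.range x) by
    refine key H.totalDegree H.totalDegree le_rfl H hH hwt (fun e he => ⟨by simp, ?_⟩) d hd
    rw [Finsupp.degree_apply]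
    exact le_totalDegree he
  intro D m
  induction m with
  | zero =>
    intro _ H hH _ hdeg d _
    by_cases hdH : d ∈ H.support
    · have hdD : d.degree = D := by have := hdeg d hdH; omega
      exact IsQuasiRegular.coeff_mem_of_degree_eq_min hx H hH D (fun e he => (hdeg e he).1) d hdD
    · rw [mem_support_iff, not_not] at hdH; rw [hdH]; exact Ideal.zero_mem _
  | succ m ih =>
    intro hmD H hH hwt hdeg d hd
    set d₀ := D - (m + 1) with hd₀
    by_cases hdH : d ∈ H.support
    swap
    · rw [mem_support_iff, not_not] at hdH; rw [hdH]; exact Ideal.zero_mem _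
    -- degree-`d₀` coefficients: quasi-regularity
    have hlow : ∀ d', d'.degree = d₀ → H.coeff d' ∈ Ideal.span (Set.range x) :=
      IsQuasiRegular.coeff_mem_of_degree_eq_min hx H hH d₀ (fun e he => (hdeg e he).1)
    by_cases hdd : d.degree = d₀
    · exact hlow d hdd
    -- otherwise push the lowest degree up and use the induction hypothesis
    set L := homogeneousComponent d₀ H with hL
    have hLI : ∀ e, L.coeff e ∈ Ideal.span (Set.range x) := by
      intro e
      rw [hL, coeff_homogeneousComponent]
      split_ifs with he
      · exact hlow e he
      · exact Ideal.zero_mem _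
    choose b hb using fun e => Ideal.mem_span_range_iff_exists_fun.mp (hLI e)
    have hLsupp : ∀ e ∈ L.support, e ∈ H.support ∧ e.degree = d₀ := by
      intro e he
      have hne : coeff e L ≠ 0 := mem_support_iff.mp he
      rw [hL, coeff_homogeneousComponent] at hne
      by_cases hed : e.degree = d₀
      · rw [if_pos hed] at hne; exact ⟨mem_support_iff.mpr hne, hed⟩
      · rw [if_neg hed] at hne; exact absurd rfl hne
    let S : MvPolynomial ι B := ∑ e ∈ L.support, ∑ i, monomial (e + Finsupp.single i 1) (b e i)
    let H' : MvPolynomial ι B := (H - L) + S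
    -- `H'(x) = 0`
    have hP : ∀ e : ι →₀ ℕ, ∀ i, (e + Finsupp.single i 1).prod (fun n k => x n ^ k) = e.prod (fun n k => x n ^ k) * x i := by
      intro e i
      rw [Finsupp.prod_add_index' (h := fun n k => x n ^ k) (fun _ => pow_zero _) (fun _ _ _ => pow_add _ _ _),
        Finsupp.prod_single_index (h := fun n k => x n ^ k) (pow_zero _), pow_one]
    have hevL : eval x L = ∑ e ∈ L.support, L.coeff e * e.prod (fun n k => x n ^ k) := by
      conv_lhs => rw [L.as_sum]
      rw [map_sum]
      exact Finset.sum_congr rfl fun e _ => eval_monomial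
    have hevS : eval x S = eval x L := by
      rw [hevL, map_sum]
      refine Finset.sum_congr rfl fun e _ => ?_
      rw [map_sum, ← hb e, Finset.sum_mul]
      refine Finset.sum_congr rfl fun i _ => ?_
      rw [eval_monomial, hP]
      ring
    have hH' : eval x H' = 0 := by
      change eval x ((H - L) + S) = 0
      rw [map_add, map_sub, hevS, hH, zero_sub, neg_add_cancel]
    -- coefficients of `S`
    have hcoefS : ∀ d', coeff d' S = ∑ e ∈ L.support, ∑ i, if e + Finsupp.single i 1 = d' then b e i else 0 := by
      intro d'
      simp only [S, coeff_sum, coeff_monomial]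
    have hS_of_ne : ∀ d', coeff d' S ≠ 0 → ∃ e ∈ L.support, ∃ i, e + Finsupp.single i 1 = d' := by
      intro d' hne
      rw [hcoefS] at hne
      obtain ⟨e, he, hne'⟩ := Finset.exists_ne_zero_of_sum_ne_zero hne
      obtain ⟨i, -, hne''⟩ := Finset.exists_ne_zero_of_sum_ne_zero hne'
      refine ⟨e, he, i, ?_⟩
      by_contra h
      rw [if_neg h] at hne''
      exact hne'' rfl
    have hwt_new : ∀ e ∈ L.support, ∀ i, ν + 1 ≤ Finsupp.weight w (e + Finsupp.single i 1) := by
      intro e he i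
      rw [map_add, Finsupp.weight_single, smul_eq_mul, one_mul]
      have := hwt e (hLsupp e he).1
      have := hw i
      omega
    have hdeg_new : ∀ e ∈ L.support, ∀ i, (e + Finsupp.single i 1).degree = d₀ + 1 := by
      intro e he i
      rw [map_add, Finsupp.degree_single, (hLsupp e he).2]
    -- support of `H'`
    have hsuppH' : ∀ e ∈ H'.support, (e ∈ H.support ∧ e.degree ≠ d₀) ∨ ∃ e₀ ∈ L.support, ∃ i, e₀ + Finsupp.single i 1 = e := by
      intro e he
      have hne : coeff e ((H - L) + S) ≠ 0 := mem_support_iff.mp he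
      rw [coeff_add, coeff_sub] at hne
      by_cases hS0 : coeff e S = 0
      · left
        rw [hS0, add_zero, hL, coeff_homogeneousComponent] at hne
        by_cases hed : e.degree = d₀
        · rw [if_pos hed, sub_self] at hne; exact absurd rfl hne
        · rw [if_neg hed, sub_zero] at hne; exact ⟨mem_support_iff.mpr hne, hed⟩
      · exact Or.inr (hS_of_ne e hS0)
    have hwtH' : ∀ e ∈ H'.support, ν ≤ Finsupp.weight w e := by
      intro e he
      rcases hsuppH' e he with ⟨heH, -⟩ | ⟨e₀, he₀, i, rfl⟩
      · exact hwt e heH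
      · exact (Nat.le_succ ν).trans (hwt_new e₀ he₀ i)
    have hdegH' : ∀ e ∈ H'.support, D - m ≤ e.degree ∧ e.degree ≤ D := by
      intro e he
      rcases hsuppH' e he with ⟨heH, hed⟩ | ⟨e₀, he₀, i, rfl⟩
      · have := hdeg e heH; omega
      · rw [hdeg_new e₀ he₀ i]; omega
    -- the coefficient of `d` is unchanged
    have hcd : H'.coeff d = H.coeff d := by
      change coeff d ((H - L) + S) = coeff d H
      rw [coeff_add, coeff_sub, hL, coeff_homogeneousComponent, if_neg hdd, sub_zero, add_eq_left]
      by_contra hne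
      obtain ⟨e₀, he₀, i, he⟩ := hS_of_ne d hne
      have := hwt_new e₀ he₀ i
      rw [he, hd] at this
      omega
    rw [← hcd]
    exact ih (Nat.le_of_succ_le hmD) H' hH' hwtH' hdegH' d hd

/-- ★★ **WEIGHTED QUASI-REGULARITY (`gr_𝒥(B) ≅ (B/I)[X]` weighted)**: `x` quasi-regular, `w > 0`; if every monomial of `H` has weight `≥ ν` and
`H(x) ∈ 𝒥_{ν+1}(x, w)`, then the coefficients of the weight-`ν` monomials of `H` lie in `I = (x)`. [OURS · L1 W4.5c; folklore] -/
theorem IsQuasiRegular.coeff_mem_of_eval_mem_weightedFiltration [Fintype ι] {x : ι → B} (hx : IsQuasiRegular x) (w : ι → ℕ) (hw : ∀ i, 0 < w i)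
    (ν : ℕ) (H : MvPolynomial ι B) (hwt : ∀ e ∈ H.support, ν ≤ Finsupp.weight w e)
    (hev : eval x H ∈ (weightedFiltration x w).ideal (ν + 1)) (d : ι →₀ ℕ) (hd : Finsupp.weight w d = ν) :
    H.coeff d ∈ Ideal.span (Set.range x) := by
  classical
  obtain ⟨G, hG, hGev⟩ := exists_mvPolynomial_of_mem_weightedFiltration x w (ν + 1) hev
  have hHG : eval x (H - G) = 0 := by rw [map_sub, hGev, sub_self]
  have hwt' : ∀ e ∈ (H - G).support, ν ≤ Finsupp.weight w e := by
    intro e he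
    rcases Finset.mem_union.mp (support_sub ι H G he) with h | h
    exacts [hwt e h, (Nat.le_succ ν).trans (hG e h)]
  have hcoef : (H - G).coeff d = H.coeff d := by
    rw [coeff_sub, sub_eq_self]
    by_contra hne
    have := hG d (mem_support_iff.mpr hne)
    omega
  rw [← hcoef]
  exact IsQuasiRegular.coeff_mem_of_eval_eq_zero hx w hw ν (H - G) hHG hwt' d hd

/-! ## GR-RED: reduced associated graded ring -/

/-- `(a + b)^N − a^N ∈ 𝒥_{N m + 1}` for `a ∈ 𝒥ₘ`, `b ∈ 𝒥ₘ₊₁` (any multiplicative filtration). [folklore] -/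
theorem add_pow_sub_pow_mem (F : IdealFiltration B) {a b : B} {m : ℕ} (ha : a ∈ F.ideal m) (hb : b ∈ F.ideal (m + 1)) (N : ℕ) :
    (a + b) ^ N - a ^ N ∈ F.ideal (N * m + 1) := by
  have haN : ∀ n : ℕ, a ^ n ∈ F.ideal (n * m) := fun n => by
    induction n with
    | zero => rw [zero_mul, F.ideal_zero]; trivial
    | succ n ihn =>
      have := F.mul_le _ _ (Ideal.mul_mem_mul ihn ha)
      rwa [← pow_succ, show n * m + m = (n + 1) * m by ring] at this
  induction N with
  | zero => rw [pow_zero, pow_zero, sub_self]; exact Ideal.zero_mem _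
  | succ N ih =>
    have e1 : (a + b) ^ (N + 1) - a ^ (N + 1) = (a + b) * ((a + b) ^ N - a ^ N) + b * a ^ N := by ring
    rw [e1]
    refine Ideal.add_mem _ ?_ ?_
    · have hab : a + b ∈ F.ideal m := Ideal.add_mem _ ha (F.antitone (Nat.le_succ m) hb)
      have := F.mul_le _ _ (Ideal.mul_mem_mul hab ih)
      rw [show m + (N * m + 1) = (N + 1) * m + 1 by ring] at this
      exact this
    · have := F.mul_le _ _ (Ideal.mul_mem_mul hb (haN N))
      rw [show m + 1 + N * m = (N + 1) * m + 1 by ring] at this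
      exact this

/-- ★★★ **GR-RED — THE WEIGHTED ASSOCIATED GRADED RING OF A QUASI-REGULAR SEQUENCE WITH REDUCED QUOTIENT IS REDUCED**: `x` quasi-regular, `w > 0`,
`B ⧸ (x)` reduced ⇒ (`y^N ∈ 𝒥_{Nm+1}(x, w)` ⇒ `y ∈ 𝒥ₘ₊₁(x, w)`, any `N`). Proof: with `m' = ord y ≤ m` write `y = F(x) + G(x)`, `F` weighted-homogeneous of weight
`m'`, `G` of weight `> m'`; then `F(x)^N ∈ 𝒥_{Nm'+1}`, so by weighted quasi-regularity all coefficients of `F^N` lie in `I`, i.e. `F̄^N = 0` in `(B/I)[X]`, which is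
reduced: `F̄ = 0`, so `F(x) ∈ I 𝒥_{m'} ⊆ 𝒥_{m'+1}` and `y ∈ 𝒥_{m'+1}` — contradiction. [OURS · L1 W4.5c · K-UNIQ v2 §A (F2); NOT a statement of the manuscript] -/
theorem mem_weightedFiltration_of_pow_mem [Fintype ι] {x : ι → B} (hx : IsQuasiRegular x) (w : ι → ℕ) (hw : ∀ i, 0 < w i)
    (hred : IsReduced (B ⧸ Ideal.span (Set.range x))) (y : B) (N m : ℕ)
    (hy : y ^ N ∈ (weightedFiltration x w).ideal (N * m + 1)) : y ∈ (weightedFiltration x w).ideal (m + 1) := by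
  classical
  by_contra hym
  -- `m' = ord y ≤ m`
  let m' := Nat.findGreatest (fun j => y ∈ (weightedFiltration x w).ideal j) m
  have hym' : y ∈ (weightedFiltration x w).ideal m' :=
    Nat.findGreatest_spec (P := fun j => y ∈ (weightedFiltration x w).ideal j) (Nat.zero_le m) (by rw [(weightedFiltration x w).ideal_zero]; trivial)
  have hm'le : m' ≤ m := Nat.findGreatest_le m
  have hnot : y ∉ (weightedFiltration x w).ideal (m' + 1) := by
    intro h
    rcases (Nat.lt_or_ge m' m) with hlt | hge
    · have := Nat.le_findGreatest (P := fun j => y ∈ (weightedFiltration x w).ideal j) (Nat.succ_le_of_lt hlt) h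
      change m' + 1 ≤ m' at this
      omega
    · have hmm : m' = m := le_antisymm hm'le hge
      rw [hmm] at h
      exact hym h
  -- `y = F(x) + G'(x)`
  obtain ⟨G, hG, hGev⟩ := exists_mvPolynomial_of_mem_weightedFiltration x w m' hym'
  set F := weightedHomogeneousComponent w m' G with hF
  have hFhom : F.IsWeightedHomogeneous w m' := weightedHomogeneousComponent_isWeightedHomogeneous m' G
  have hG' : ∀ e ∈ (G - F).support, m' + 1 ≤ Finsupp.weight w e := by
    intro e he
    have hne : coeff e (G - F) ≠ 0 := mem_support_iff.mp he
    rw [coeff_sub, hF, coeff_weightedHomogeneousComponent] at hne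
    by_cases hew : Finsupp.weight w e = m'
    · rw [if_pos hew, sub_self] at hne; exact absurd rfl hne
    · rw [if_neg hew, sub_zero] at hne
      have := hG e (mem_support_iff.mpr hne)
      omega
  have hG'ev : eval x (G - F) ∈ (weightedFiltration x w).ideal (m' + 1) := eval_mem_weightedFiltration_of_le_weight x w _ _ hG'
  have hFev : eval x F ∈ (weightedFiltration x w).ideal m' :=
    eval_mem_weightedFiltration_of_le_weight x w _ _ fun e he => (hFhom (mem_support_iff.mp he)).ge
  have hysplit : y = eval x F + eval x (G - F) := by rw [map_sub, add_sub_cancel, hGev]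
  -- `F(x)^N ∈ 𝒥_{N m' + 1}`
  have hFN : eval x (F ^ N) ∈ (weightedFiltration x w).ideal (N * m' + 1) := by
    have h1 : y ^ N ∈ (weightedFiltration x w).ideal (N * m' + 1) :=
      (weightedFiltration x w).antitone (by nlinarith) hy
    have h2 := add_pow_sub_pow_mem (weightedFiltration x w) hFev hG'ev N
    rw [← hysplit] at h2
    have := Ideal.sub_mem _ h1 h2
    rwa [sub_sub_cancel, ← map_pow] at this
  -- all coefficients of `F^N` lie in `I`
  have hFNhom : (F ^ N).IsWeightedHomogeneous w (N * m') := by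
    have := hFhom.pow N
    rwa [smul_eq_mul] at this
  have hcoefFN : ∀ d, (F ^ N).coeff d ∈ Ideal.span (Set.range x) := by
    intro d
    by_cases hdw : Finsupp.weight w d = N * m'
    · exact IsQuasiRegular.coeff_mem_of_eval_mem_weightedFiltration hx w hw (N * m') (F ^ N) (fun e he => (hFNhom (mem_support_iff.mp he)).ge) hFN d hdw
    · rw [hFNhom.coeff_eq_zero d hdw]; exact Ideal.zero_mem _
  -- `F̄` is nilpotent in the reduced ring `(B/I)[X]`, hence `0`: all coefficients of `F` lie in `I`
  have hmapN : (MvPolynomial.map (Ideal.Quotient.mk (Ideal.span (Set.range x))) F) ^ N = 0 := by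
    rw [← map_pow]
    ext d
    rw [coeff_map, coeff_zero, Ideal.Quotient.eq_zero_iff_mem]
    exact hcoefFN d
  have hmap0 : MvPolynomial.map (Ideal.Quotient.mk (Ideal.span (Set.range x))) F = 0 := IsNilpotent.eq_zero ⟨N, hmapN⟩
  have hcoefF : ∀ d, F.coeff d ∈ Ideal.span (Set.range x) := by
    intro d
    have := congrArg (coeff d) hmap0
    rw [coeff_map, coeff_zero, Ideal.Quotient.eq_zero_iff_mem] at this
    exact this
  -- hence `F(x) ∈ I 𝒥_{m'} ⊆ 𝒥_{m'+1}` and `y ∈ 𝒥_{m'+1}`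
  have hFev' : eval x F ∈ (weightedFiltration x w).ideal (m' + 1) := by
    rw [F.as_sum, map_sum]
    refine Ideal.sum_mem _ fun e he => ?_
    rw [eval_monomial]
    refine span_mul_weightedFiltration_le x w hw m' (Ideal.mul_mem_mul (hcoefF e) (Ideal.subset_span ⟨e, ?_, rfl⟩))
    exact (hFhom (mem_support_iff.mp he)).ge
  exact hnot (hysplit ▸ Ideal.add_mem _ hFev' hG'ev)

/-- ★★★ **GR-RED for a weakly regular sequence** `f : Fin c → B` with `B ⧸ (f)` reduced and positive weights: `y^N ∈ 𝒥_{Nm+1}(f, w)` ⇒ `y ∈ 𝒥ₘ₊₁(f, w)`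
— hypothesis GR-RED of K-LEAST (`weightedFiltration_le_of_kill_of_filtration`) for the weighted filtration of a regular centre (Rees' theorem
`isQuasiRegular_of_isWeaklyRegular`). [OURS · L1 W4.5c; NOT a statement of the manuscript] -/
theorem mem_weightedFiltration_of_pow_mem_of_isWeaklyRegular {c : ℕ} (f : Fin c → B) (w : Fin c → ℕ) (hw : ∀ i, 0 < w i)
    (hreg : RingTheory.Sequence.IsWeaklyRegular B (List.ofFn f)) (hred : IsReduced (B ⧸ Ideal.span (Set.range f)))
    (y : B) (N m : ℕ) (hy : y ^ N ∈ (weightedFiltration f w).ideal (N * m + 1)) :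
    y ∈ (weightedFiltration f w).ideal (m + 1) :=
  mem_weightedFiltration_of_pow_mem (isQuasiRegular_of_isWeaklyRegular f hreg) w hw hred y N m hy

end Summit.ResolutionOfSingularities.ResolutionOfSingularities.Theorems.WildQuotientResolution.S1.KillCert

end
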